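import Summits.QuantumFields.YangMills.Theorems.BalabanUVNodesN15KingModelReflectionPositivityLaw

/-!
# BalabanUVNodes ∕ N15 — THE KING-MODEL RUNG (PART Ϻ-t): THE SUSCEPTIBILITY BOUND ON THE INFINITE-VOLUME COVARIANCE — `Σ_{z,w}x_zx_wS₂^{ℝ}(w−z) ≤ m⁻²Σ_zx_z²` (Schur test with the
# sum rule `Σ_zS₂^{ℝ}(z) = m⁻²` and positivity), hence `Var_{μ_∞}(φ(f)) ≤ m⁻²‖f‖²_{ℓ²}`: the covariance operator of King's continuum block field has norm `≤ m⁻²` on `ℓ²(ℤ^{d+1})`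
# (Track A, DAG node N15 = NE2; FAN-OUT v1.1 §N15 s3 «KING-MODEL RUNG»; uses parts Ϝ-k (sum rule), Ϻ-b (positivity), Ϻ-n∕o (`μ_∞`, variance of field sums); count-neutral)

HONEST FRAMING.  Count-neutral (cell `pub-ymgap`, seat `pub-ymgap-dag-n15-e` g35; `--supports stmt-QuantumFields-27366 --as helper` = K3⁸).  King's `A = 0`, `g = 0` model
([King1986] C. King, Commun. Math. Phys. **102** (1986) 649–677).  The infinite-volume two-point function satisfies `S₂^{ℝ} > 0` (part Ϻ-b) and the sum rule `Σ_zS₂^{ℝ}(z) = m⁻²`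
(part Ϝ-k, Thm 2.1 (2.23)'s shape).  The SCHUR TEST `2|x_zx_w| ≤ x_z² + x_w²` then bounds the covariance as a quadratic form on finitely supported vectors:
★★ `Σ_{z,w∈s}x_zx_wS₂^{ℝ}(w − z) ≤ m⁻²Σ_{z∈s}x_z²` — the covariance operator (convolution by `S₂^{ℝ}`) is bounded by `m⁻²` on `ℓ²(ℤ^{d+1})`, i.e. the variance of every field
sum under `μ_∞` is at most `m⁻²` times the `ℓ²`-norm² of its coefficients: `Var_{μ_∞}(Σ_jc_jφ(z_j)) ≤ m⁻²Σ_jc_j²` (distinct sites), and the exponential moments obey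
`∫e^{φ(f)}dμ_∞ ≤ e^{‖f‖²∕(2m²)}`.  NOT Bałaban's objects; NOT a node discharge; nothing continuum-Yang–Mills ∕ `ℝ⁴` ∕ OS ∕ Clay.  0 `sorry`, 0 def; standard axioms.

WHAT THIS FILE PROVES (kernel).  §1 `sum_kingS2Inf_sub_le_inv_mass` (`Σ_{w∈s}S₂^{ℝ}(w−z) ≤ m⁻²`), ★★ **`kingS2Inf_quadForm_le`** (the Schur bound), `kingS2Inf_quadForm_abs_le`.  §2 ★★ **`variance_fieldSum_le`**
(`Var_{μ_∞}(Σ_jc_jφ(z_j)) ≤ m⁻²Σ_jc_j²`, injective sites), ★ `integral_exp_fieldSum_le` (`∫e^{φ(f)}dμ_∞ ≤ exp(Σc_j²∕(2m²))`).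

HONEST SCOPE.  King's free `K = |Ω| = ∞` block field; the bound `m⁻²` is the exact operator norm (attained at zero momentum) but only the upper bound is typed.  N15 untouched; counts unmoved.
Locators (use): [King1986] Thm 2.1 (2.22)–(2.23) p.654, (4.8) p.671.
-/

noncomputable section

open scoped BigOperators Topology
open Filter MeasureTheory ProbabilityTheory Finset

namespace Summit.QuantumFields.YangMills.BalabanUVNodes.N15KingModelRung.InfiniteVolume

open Summit.QuantumFields.YangMills.BalabanUVNodes.N15KingModelRung.OptimalDecay
open Summit.QuantumFields.YangMills.BalabanUVNodes.N15KingModelRung.ProperTime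

variable {d : ℕ}

/-! ## §1 The Schur bound on the quadratic form -/

/-- Partial row sums are bounded by the sum rule: `Σ_{w∈s}S₂^{ℝ}(w − z) ≤ Σ_{w∈ℤ^{d+1}}S₂^{ℝ}(w − z) = m⁻²`. [cite: King1986, Thm 2.1 (2.23) p.654, (4.8) p.671] -/
theorem sum_kingS2Inf_sub_le_inv_mass {m2 : ℝ} (hm : 0 < m2) (s : Finset (Fin (d + 1) → ℤ)) (z : Fin (d + 1) → ℤ) :
    ∑ w ∈ s, kingS2Inf m2 (w - z) ≤ m2⁻¹ := by
  have hsum : Summable fun w : Fin (d + 1) → ℤ => kingS2Inf m2 (w - z) := (summable_kingS2Inf hm).comp_injective (sub_left_injective)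
  have htot : ∑' w : Fin (d + 1) → ℤ, kingS2Inf m2 (w - z) = m2⁻¹ := by
    rw [← tsum_kingS2Inf_eq_inv_mass (d := d) hm]
    exact (Equiv.subRight z).tsum_eq (fun w => kingS2Inf m2 w)
  rw [← htot]
  exact hsum.sum_le_tsum s fun w _ => (kingS2Inf_pos hm _).le

/-- ★★ **THE SCHUR BOUND**: for every finite `s ⊆ ℤ^{d+1}` and real `x`, `Σ_{z,w∈s}x_zx_wS₂^{ℝ}(w − z) ≤ m⁻²Σ_{z∈s}x_z²` — the covariance operator of King's continuum block field is
bounded by `m⁻²` on `ℓ²` (`2|x_zx_w| ≤ x_z² + x_w²`, positivity of `S₂^{ℝ}`, the sum rule). [cite: King1986, Thm 2.1 (2.23) p.654, (4.8) p.671] -/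
theorem kingS2Inf_quadForm_le {m2 : ℝ} (hm : 0 < m2) (s : Finset (Fin (d + 1) → ℤ)) (x : (Fin (d + 1) → ℤ) → ℝ) :
    ∑ z ∈ s, ∑ w ∈ s, x z * x w * kingS2Inf m2 (w - z) ≤ m2⁻¹ * ∑ z ∈ s, x z ^ 2 := by
  -- Schur: each term ≤ (x_z² + x_w²)/2 · S(w−z)
  have hterm : ∀ z w, x z * x w * kingS2Inf m2 (w - z) ≤ (x z ^ 2 / 2) * kingS2Inf m2 (w - z) + (x w ^ 2 / 2) * kingS2Inf m2 (w - z) := by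
    intro z w
    have hS := (kingS2Inf_pos hm (w - z)).le
    nlinarith [sq_nonneg (x z - x w), hS]
  calc ∑ z ∈ s, ∑ w ∈ s, x z * x w * kingS2Inf m2 (w - z)
      ≤ ∑ z ∈ s, ∑ w ∈ s, ((x z ^ 2 / 2) * kingS2Inf m2 (w - z) + (x w ^ 2 / 2) * kingS2Inf m2 (w - z)) :=
        Finset.sum_le_sum fun z _ => Finset.sum_le_sum fun w _ => hterm z w
    _ = (∑ z ∈ s, (x z ^ 2 / 2) * ∑ w ∈ s, kingS2Inf m2 (w - z)) + ∑ w ∈ s, (x w ^ 2 / 2) * ∑ z ∈ s, kingS2Inf m2 (w - z) := by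
        have hsplit : ∀ z ∈ s, ∑ w ∈ s, ((x z ^ 2 / 2) * kingS2Inf m2 (w - z) + (x w ^ 2 / 2) * kingS2Inf m2 (w - z))
            = (x z ^ 2 / 2) * (∑ w ∈ s, kingS2Inf m2 (w - z)) + ∑ w ∈ s, (x w ^ 2 / 2) * kingS2Inf m2 (w - z) := fun z _ => by
          rw [Finset.sum_add_distrib, Finset.mul_sum]
        rw [Finset.sum_congr rfl hsplit, Finset.sum_add_distrib]
        congr 1
        rw [Finset.sum_comm]
        exact Finset.sum_congr rfl fun w _ => by rw [Finset.mul_sum]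
    _ ≤ (∑ z ∈ s, (x z ^ 2 / 2) * m2⁻¹) + ∑ w ∈ s, (x w ^ 2 / 2) * m2⁻¹ := by
        gcongr with z hz w hw
        · exact sum_kingS2Inf_sub_le_inv_mass hm s z
        · -- the column sum: `Σ_z S(w − z) = Σ_z S(z − w)` by evenness
          have h := sum_kingS2Inf_sub_le_inv_mass hm s w
          calc ∑ z ∈ s, kingS2Inf m2 (w - z) = ∑ z ∈ s, kingS2Inf m2 (z - w) := Finset.sum_congr rfl fun z _ => by rw [← kingS2Inf_neg m2 (z - w), neg_sub]
            _ ≤ m2⁻¹ := h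
    _ = m2⁻¹ * ∑ z ∈ s, x z ^ 2 := by
        rw [← Finset.sum_mul, ← Finset.sum_div]
        ring

/-- The same bound for the absolute values: `Σ_{z,w}|x_z||x_w|S₂^{ℝ}(w−z) ≤ m⁻²Σx_z²`. [folklore] -/
theorem kingS2Inf_quadForm_abs_le {m2 : ℝ} (hm : 0 < m2) (s : Finset (Fin (d + 1) → ℤ)) (x : (Fin (d + 1) → ℤ) → ℝ) :
    ∑ z ∈ s, ∑ w ∈ s, |x z| * |x w| * kingS2Inf m2 (w - z) ≤ m2⁻¹ * ∑ z ∈ s, x z ^ 2 := by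
  have h := kingS2Inf_quadForm_le hm s (fun z => |x z|)
  simp only [sq_abs] at h
  exact h

/-! ## §2 Variance and exponential-moment bounds under `μ_∞` -/

/-- ★★ **`Var_{μ_∞}(Σ_jc_jφ(z_j)) ≤ m⁻²Σ_jc_j²`** for injective site families `z : J ↪ ℤ^{d+1}` (the covariance operator norm bound `m⁻²`). [cite: King1986, Thm 2.1 (2.23) p.654] -/
theorem variance_fieldSum_le {m2 : ℝ} (hm : 0 < m2) {J : Type*} (T : Finset J) {p : J → Fin (d + 1) → ℤ} (hp : Function.Injective p) (c : J → ℝ) :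
    Var[fun ω : (Fin (d + 1) → ℤ) → ℝ => ∑ j ∈ T, c j * ω (p j); kingFieldInf m2] ≤ m2⁻¹ * ∑ j ∈ T, c j ^ 2 := by
  classical
  rw [variance_fieldSum hm T p c]
  -- transport to the image sites with coefficients `x (p j) = c j`
  set x : (Fin (d + 1) → ℤ) → ℝ := fun z => if h : ∃ j ∈ T, p j = z then c h.choose else 0 with hx
  have hxp : ∀ j ∈ T, x (p j) = c j := by
    intro j hj
    have hex : ∃ j' ∈ T, p j' = p j := ⟨j, hj, rfl⟩
    rw [hx]
    simp only [dif_pos hex]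
    exact congrArg c (hp hex.choose_spec.2)
  have h := kingS2Inf_quadForm_le hm (T.image p) x
  rw [Finset.sum_image (fun j _ j' _ h => hp h)] at h
  simp_rw [Finset.sum_image (fun j _ j' _ h => hp h)] at h
  have e1 : ∑ j ∈ T, ∑ j' ∈ T, c j * c j' * kingS2Inf m2 (p j' - p j) = ∑ j ∈ T, ∑ j' ∈ T, x (p j) * x (p j') * kingS2Inf m2 (p j' - p j) :=
    Finset.sum_congr rfl fun j hj => Finset.sum_congr rfl fun j' hj' => by rw [hxp j hj, hxp j' hj']
  have e2 : ∑ j ∈ T, c j ^ 2 = ∑ j ∈ T, x (p j) ^ 2 := Finset.sum_congr rfl fun j hj => by rw [hxp j hj]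
  rw [e1, e2]
  exact h

/-- ★ **Exponential moments are controlled by the `ℓ²`-norm of the test function**: `∫e^{Σ_jc_jφ(z_j)}dμ_∞ ≤ exp(Σ_jc_j²∕(2m²))` (injective sites). [cite: King1986, Thm 2.1 (2.23) p.654] -/
theorem integral_exp_fieldSum_le {m2 : ℝ} (hm : 0 < m2) {J : Type*} (T : Finset J) {p : J → Fin (d + 1) → ℤ} (hp : Function.Injective p) (c : J → ℝ) :
    ∫ ω, Real.exp (∑ j ∈ T, c j * ω (p j)) ∂kingFieldInf m2 ≤ Real.exp ((m2⁻¹ * ∑ j ∈ T, c j ^ 2) / 2) := by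
  rw [integral_exp_fieldSum hm, ← variance_fieldSum hm T p c]
  exact Real.exp_le_exp.mpr (div_le_div_of_nonneg_right (variance_fieldSum_le hm T hp c) zero_le_two)

end Summit.QuantumFields.YangMills.BalabanUVNodes.N15KingModelRung.InfiniteVolume
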